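import Mathlib
import Summits.Ventures.PercRepro2.Defs
import Summits.Ventures.PercRepro2.Independence
import Summits.Ventures.PercRepro2.Harris
import Summits.Ventures.PercRepro2.Graph
import Summits.Ventures.PercRepro2.Exploration
import Summits.Ventures.PercRepro2.Events
import Summits.Ventures.PercRepro2.FourFunctions
import Summits.Ventures.PercRepro2.Induced
import Summits.Ventures.PercRepro2.Frontier
import Summits.Ventures.PercRepro2.ObsIndependence
import Summits.Ventures.PercRepro2.BHK
import Summits.Ventures.PercRepro2.BHKEvents
import Summits.Ventures.PercRepro2.VdBKahn
import Summits.Ventures.PercRepro2.BHKAvoid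
import Summits.Ventures.PercRepro2.R2PrimeThreeReduction
import Summits.Ventures.PercRepro2.YBridge
import Summits.Ventures.PercRepro2.Yu1Functionals
import Summits.Ventures.PercRepro2.Yu1Events
import Summits.Ventures.PercRepro2.Yu1
import Summits.Ventures.PercRepro2.LBSplit
import Summits.Ventures.PercRepro2.YDelta
import Summits.Ventures.PercRepro2.YDeltaTools
import Summits.Ventures.PercRepro2.SD
import Summits.Ventures.PercRepro2.Lambda
import Summits.Ventures.PercRepro2.LambdaTau
import Summits.Ventures.PercRepro2.LambdaSlack
import Summits.Ventures.PercRepro2.ZDelta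
import Summits.Ventures.PercRepro2.ZExpand
import Summits.Ventures.PercRepro2.LightFirst

/-!
# The light-first exploration identity `Z = C + D · (Δ_h − K)` — the identity (blind cell PercRepro2,
typer-1; mine-2 `proofs/MINE2-JLEMMA.md` §23 (12), lead g8 ask 2026-08-23T02:57:32Z)

On the coordinates of `LightFirst` (`eta`, `sShare`, `rRatio`, `Cterm`, `Kterm`; towers `tower_PDoH`,
`tower_Thl`, `Xl_eq_expect`; moment identities):

* `Kterm_eq`: `K = E[η (1_b − β); R]` (on `R` the product `1_b β` vanishes);
* `Kterm_eq_Thl_sub`: `K = T_{h→l} − E[η ψ; R]`;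
* **`Z_lightFirst`**: the (ZΔ)-slack is `Z = C + D · (Δ_h − K)` for every `IsProbVec p` (no
  positivity hypothesis); `ZDelta_iff_lightFirst`: `(ZΔ) ↔ 0 ≤ C + D (Δ_h − K)`;
* **`L2_lightFirst`**: `Z_0 + Z_h = C − D · K` (`Z_l = D Δ_h`);
* `Cterm_eq_moments`: when `u ≠ 0` on `R`, `C = E[u s] E[u r] − E[u] E[u s r]` (mine-2's
  `−D² · Cov_P̃(s, r)` under the PD-law of the light cluster).

Identities only (NEG-39, lead g8 03:11:11Z / 03:16:54Z): neither `C` nor the payer `Δ_h − K` is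
sign-definite in any class (engine D33: payer 8 violations at n = 5, 128 at n = 6 of which 4 with
`a₃ = argmin`; `C < 0` on 4.5 %; `K ≤ 0` false from n = 6), and the two negatives never coincide —
an exact reformulation (second implementation: engine D33, identity asserted on 1.4M instances at
n ≤ 6), not a lemma ladder; no row is typed here.
-/

namespace Summit.Ventures.PercRepro2

open UnionCluster Yu1

namespace LightFirst

section Identity

variable {V : Type*} {E : Type*} [Fintype E] [DecidableEq E] [Fintype V] [DecidableEq V]
  {R : Type*} [Field R] [LinearOrder R] [IsStrictOrderedRing R]

omit [Fintype V] [LinearOrder R] [IsStrictOrderedRing R] in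
/-- `K = E[η (1_b − β); R]`: on `R` the product `1_b β` vanishes (`beta_eq_zero_of_mem`). -/
theorem Kterm_eq (p : E → R) (ends : E → Sym2 V) (o a₁ a₂ a₃ b : V) :
    Kterm p ends o a₁ a₂ a₃ b =
      expect p (fun ω => eta p ends o a₂ a₃ (cluster ends ω a₁) *
        (ind b (cluster ends ω a₁) - beta p ends a₂ b (cluster ends ω a₁)) *
        (avoidAll ends a₁ {a₂, a₃}).indicator 1 ω) := by
  unfold Kterm
  refine expect_congr_on fun ω hω => ?_
  have ha₂ : a₂ ∉ cluster ends ω a₁ :=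
    notMem_cluster_of_mem_avoidAll (Finset.mem_insert_self a₂ {a₃}) hω
  by_cases hb : b ∈ cluster ends ω a₁
  · have hβ : beta p ends a₂ b (cluster ends ω a₁) = 0 :=
      beta_eq_zero_of_mem p ends (by rintro rfl; exact ha₂ hb) hb
    rw [hβ]
    ring
  · have h0 : (ind b (cluster ends ω a₁) : R) = 0 := by
      unfold ind
      exact Set.indicator_of_notMem (show cluster ends ω a₁ ∉ {W : Set V | b ∈ W} from hb) _
    rw [h0]
    ring

/-- `K = T_{h→l} − E[η ψ; R]` (with `T_{h→l} = E[1_b q_o; R]` and `q_o = u η`). -/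
theorem Kterm_eq_Thl_sub (p : E → R) (hp : IsProbVec p) (ends : E → Sym2 V) (o a₁ a₂ a₃ b : V) :
    Kterm p ends o a₁ a₂ a₃ b =
      prob p (PDEvent ends a₁ a₂ a₃ ∩ connEvent ends a₂ o ∩ connEvent ends a₁ b) -
        expect p (fun ω => eta p ends o a₂ a₃ (cluster ends ω a₁) *
          psi p ends a₂ a₃ b (cluster ends ω a₁) * (avoidAll ends a₁ {a₂, a₃}).indicator 1 ω) := by
  rw [Kterm_eq, tower_Thl]
  unfold expect
  rw [← Finset.sum_sub_distrib]
  refine Finset.sum_congr rfl fun ω _ => ?_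
  dsimp only
  by_cases hω : ω ∈ avoidAll ends a₁ {a₂, a₃}
  · have hq := u_mul_eta p hp ends o a₂ a₃ (cluster ends ω a₁)
    have ha₂ : a₂ ∉ cluster ends ω a₁ :=
      notMem_cluster_of_mem_avoidAll (Finset.mem_insert_self a₂ {a₃}) hω
    by_cases hb : b ∈ cluster ends ω a₁
    · have hβ : beta p ends a₂ b (cluster ends ω a₁) = 0 :=
        beta_eq_zero_of_mem p ends (by rintro rfl; exact ha₂ hb) hb
      have h1 : (ind b (cluster ends ω a₁) : R) = 1 := by
        unfold ind
        rw [Set.indicator_of_mem (show cluster ends ω a₁ ∈ {W : Set V | b ∈ W} from hb)]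
        rfl
      unfold psi
      rw [hβ, h1, ← hq]
      ring
    · have h0 : (ind b (cluster ends ω a₁) : R) = 0 := by
        unfold ind
        exact Set.indicator_of_notMem (show cluster ends ω a₁ ∉ {W : Set V | b ∈ W} from hb) _
      unfold psi
      rw [h0]
      ring
  · simp [Set.indicator_of_notMem hω]

/-- **The light-first exploration identity** (mine-2 §23 (12)): the (ZΔ)-slack is
`Z = C + D · (Δ_h − K)`. -/
theorem Z_lightFirst (p : E → R) (hp : IsProbVec p) (ends : E → Sym2 V) (o a₁ a₂ a₃ b : V) :
    (prob p (PDEvent ends a₁ a₂ a₃ ∩ connEvent ends a₁ o) +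
          prob p (PDEvent ends a₁ a₂ a₃ ∩ connEvent ends a₂ o)) *
        (massM2 p ends a₁ a₂ a₃ b + deltaT p ends a₁ a₂ a₃ b) -
      ((prob p (PDEvent ends a₁ a₂ a₃ ∩ connEvent ends a₁ o ∩ connEvent ends a₂ b) -
            deltaL p ends o a₁ a₂ a₃ b) +
          (prob p (PDEvent ends a₁ a₂ a₃ ∩ connEvent ends a₂ o ∩ connEvent ends a₁ b) -
            deltaH p ends o a₁ a₂ a₃ b)) * prob p (PDEvent ends a₁ a₂ a₃) =
      Cterm p ends o a₁ a₂ a₃ b +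
        prob p (PDEvent ends a₁ a₂ a₃) *
          (deltaH p ends o a₁ a₂ a₃ b - Kterm p ends o a₁ a₂ a₃ b) := by
  have hXl := Xl_eq_expect p ends o a₁ a₂ a₃ b
  have hs := expect_sShare_psi p ends o a₁ a₂ a₃ b
  have hK := Kterm_eq_Thl_sub p hp ends o a₁ a₂ a₃ b
  unfold Cterm
  linear_combination (-(prob p (PDEvent ends a₁ a₂ a₃))) * hXl +
    prob p (PDEvent ends a₁ a₂ a₃) * hs + prob p (PDEvent ends a₁ a₂ a₃) * hK

/-- **(ZΔ) in light-first coordinates**: `ZDelta ↔ 0 ≤ C + D · (Δ_h − K)`. -/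
theorem ZDelta_iff_lightFirst (p : E → R) (hp : IsProbVec p) (ends : E → Sym2 V)
    (o a₁ a₂ a₃ b : V) :
    ZDelta p ends o a₁ a₂ a₃ b ↔
      0 ≤ Cterm p ends o a₁ a₂ a₃ b +
        prob p (PDEvent ends a₁ a₂ a₃) *
          (deltaH p ends o a₁ a₂ a₃ b - Kterm p ends o a₁ a₂ a₃ b) := by
  rw [← Z_lightFirst p hp]
  unfold ZDelta
  constructor
  · intro h
    linarith
  · intro h
    linarith

/-- **L2 in light-first coordinates**: `Z_0 + Z_h = C − D · K` (`Z_l = D Δ_h`). -/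
theorem L2_lightFirst (p : E → R) (hp : IsProbVec p) (ends : E → Sym2 V) (o a₁ a₂ a₃ b : V) :
    Z0 p ends o a₁ a₂ a₃ b + Zh p ends o a₁ a₂ a₃ b =
      Cterm p ends o a₁ a₂ a₃ b - prob p (PDEvent ends a₁ a₂ a₃) * Kterm p ends o a₁ a₂ a₃ b := by
  have hcut := Z_location_cut p ends o a₁ a₂ a₃ b
  have hZl := Zl_eq_deltaH p ends o a₁ a₂ a₃ b
  have hZ := Z_lightFirst p hp ends o a₁ a₂ a₃ b
  linear_combination hZ - hcut - hZl

/-- **`C` in moment form** (mine-2's definition): when `u ≠ 0` on `R`,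
`C = E[u s; R] · E[u r; R] − E[u; R] · E[u s r; R]` (`= −D² · Cov_P̃(s, r)` under the PD-law of the
light cluster). -/
theorem Cterm_eq_moments (p : E → R) (hp : IsProbVec p) (ends : E → Sym2 V) (o a₁ a₂ a₃ b : V)
    (hu : ∀ ω ∈ avoidAll ends a₁ {a₂, a₃}, u p ends a₂ a₃ (cluster ends ω a₁) ≠ 0) :
    Cterm p ends o a₁ a₂ a₃ b =
      expect p (fun ω => u p ends a₂ a₃ (cluster ends ω a₁) *
          sShare p ends o a₂ a₃ (cluster ends ω a₁) * (avoidAll ends a₁ {a₂, a₃}).indicator 1 ω) *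
        expect p (fun ω => u p ends a₂ a₃ (cluster ends ω a₁) *
          rRatio p ends a₂ a₃ b (cluster ends ω a₁) * (avoidAll ends a₁ {a₂, a₃}).indicator 1 ω) -
      expect p (fun ω => u p ends a₂ a₃ (cluster ends ω a₁) *
          (avoidAll ends a₁ {a₂, a₃}).indicator 1 ω) *
        expect p (fun ω => u p ends a₂ a₃ (cluster ends ω a₁) *
          sShare p ends o a₂ a₃ (cluster ends ω a₁) * rRatio p ends a₂ a₃ b (cluster ends ω a₁) *
          (avoidAll ends a₁ {a₂, a₃}).indicator 1 ω) := by
  rw [expect_u_sShare p hp, expect_u_rRatio p ends a₁ a₂ a₃ b hu, Lambda.expect_u_eq,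
    expect_u_sShare_rRatio p ends o a₁ a₂ a₃ b hu]
  rfl

end Identity

end LightFirst

end Summit.Ventures.PercRepro2
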